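import Summits.Ventures.Crystal3D.Theorems.StickyWulffConstantPolycrystalWulffBoundChargedWalls
import Summits.Ventures.Crystal3D.Theorems.StickyWulffConstantPolycrystalWulffBoundIntersectionBody
import Summits.Ventures.Crystal3D.Theorems.StickyWulffConstantPolycrystalWulffBoundWulffOverlapCap

/-!
# `PolycrystalWulffBound`, line `PolyDensity`: the TWO-CLASS ROWS WITH THE BALL CUT — energy split,
# per-class Wulff bounds for BOTH classes, inradius bound, and the new ball-cut row, with SHARED
# variables (crux `stmt-Ventures-19482`; lane poly-p2, gen 24)

Route `StickyWulffConstant` of the venture `Summits/Ventures/Crystal3D`, second prover lane.  Companion of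
`…DominantCharged` (whose proof text is reused): for a twin-free polyhedral crux texture with at most two
lattice classes, generic charge `≥ c₁ ≥ 0` and a chosen class `D ∋ f₀` (volume `v_D`; the other class
`S`, volume `s = Vol − v_D`), there are the free energies `F_D, F_S` of the two classes, the satellites'
exterior unit-ball area `Y ≥ 0` and the unit-ball interface `A₁ ≥ 0` of `D` with `S`, such that

* ENERGY SPLIT      `F_D + F_S + c₁·A₁ ≤ En` (walls between the classes are generic, charged `≥ c₁`);
* PER-CLASS WULFF   `w(v_D) ≤ F_D + √5·A₁` and `w(s) ≤ F_S + √5·A₁` (each class is one body; its walls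
  cost at most the circumradius `√5` per unit ball-area);
* INRADIUS          `√3·Y ≤ F_S` (`B̄(0,√3) ⊆ W`);
* BALL CUT (new)    `3·(π(24√3−32))^{1/3}·Vol^{2/3} ≤ F_D + 2·Y`: the symmetric convex body
  `L = W_D ∩ B̄(0,2)` has `h_L ≤ h_{W_D}` and `h_L ≤ 2`, so `per_L(E) ≤ F_D + 2·Y`
  (`per_iUnion_le_freeEnergy` with bodies `W_D` on `D` and `B̄(0,2)` on `S`), while
  `per_L(E) ≥ 3|L|^{1/3}|E|^{2/3}` (`wulff_le_per`) and `|L| ≥ π(24√3 − 32) = 30.06`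
  (`volume_cruxWulffBody_inter_closedBall_two_ge`).

(`w(v) = 6·2^{1/3}(√2 v)^{2/3}`.)  With `…TwoClassOneArith` these rows close the two-lattice rung AT THE
CRUX'S CHARGE `1` on the mid band `v_D ∈ [(3/4)Vol, (17/20)Vol]` (`…RungTwinFreeTwoClassesOne`).
WHAT THIS IS NOT: a rung by itself; twins; the crux is not claimed.
-/

noncomputable section

open scoped BigOperators InnerProductSpace ENNReal
open MeasureTheory Filter

namespace Summit.Ventures.Crystal3D.Cruxes.PolycrystalWulffBound.PolyDensity

open Summit.Ventures.Crystal3D.Theorems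
open Summit.Ventures.Crystal3D.Cruxes.TextureLiminf.TexShadow (per polytope E3 facetArea supportFn)
open Literature.MathematicalPhysics.StatisticalMechanics (perimeter)

set_option maxHeartbeats 400000 in
/-- **Two-class rows with the ball cut at generic charge `≥ c₁`** (energy split, per-class Wulff bounds
for both classes, inradius bound, ball-cut row) for any chosen class `D ∋ f₀` of a twin-free polyhedral
crux texture with at most two lattice classes.  See the module docstring. -/
theorem twinFree_twoClass_ballCut_rows :
    let Λ : Set (EuclideanSpace ℝ (Fin 3)) := Literature.MathematicalPhysics.StatisticalMechanics.fccStacking 1 (Real.sqrt (2 / 3));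
    let Brl : (ℤ → ℤ) → Set (EuclideanSpace ℝ (Fin 3)) := Literature.MathematicalPhysics.StatisticalMechanics.barlowStacking 1 (Real.sqrt (2 / 3));
    let Ax : EuclideanSpace ℝ (Fin 3) → (EuclideanSpace ℝ (Fin 3) ≃ₗᵢ[ℝ] EuclideanSpace ℝ (Fin 3)) → (EuclideanSpace ℝ (Fin 3) ≃ₗᵢ[ℝ] EuclideanSpace ℝ (Fin 3)) → Prop := fun m A B => ∃ (L : EuclideanSpace ℝ (Fin 3) ≃ₗᵢ[ℝ] EuclideanSpace ℝ (Fin 3)) (s₁ s₂ : EuclideanSpace ℝ (Fin 3)) (σ σ' : ℤ → ℤ), Literature.MathematicalPhysics.StatisticalMechanics.IsHaggSeq σ ∧ Literature.MathematicalPhysics.StatisticalMechanics.IsHaggSeq σ' ∧ L (EuclideanSpace.single (2 : Fin 3) (1 : ℝ)) = m ∧ A '' Λ ⊆ (fun q => L q + s₁) '' Brl σ ∧ B '' Λ ⊆ (fun q => L q + s₂) '' Brl σ';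
    let CoAx : (EuclideanSpace ℝ (Fin 3) ≃ₗᵢ[ℝ] EuclideanSpace ℝ (Fin 3)) → (EuclideanSpace ℝ (Fin 3) ≃ₗᵢ[ℝ] EuclideanSpace ℝ (Fin 3)) → Prop := fun A B => ∃ m, Ax m A B;
    let Φ : EuclideanSpace ℝ (Fin 3) → ℝ := fun ν => Real.sqrt 2 / 4 * ∑ᶠ w ∈ {w ∈ Λ | ‖w‖ = 1}, |⟪w, ν⟫_ℝ|;
    let Per : Set (EuclideanSpace ℝ (Fin 3)) → Set (EuclideanSpace ℝ (Fin 3)) → ℝ := fun K S => (⨆ (ξ : EuclideanSpace ℝ (Fin 3) → EuclideanSpace ℝ (Fin 3)) (_ : ContDiff ℝ 1 ξ ∧ HasCompactSupport ξ ∧ ∀ z, ξ z ∈ K), ENNReal.ofReal (∫ z in S, Literature.MathematicalPhysics.StatisticalMechanics.fieldDivergence ξ z)).toReal;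
    let ι : Set (EuclideanSpace ℝ (Fin 3)) → Set (EuclideanSpace ℝ (Fin 3)) → Set (EuclideanSpace ℝ (Fin 3)) → ℝ := fun K S₁ S₂ => (Per K S₁ + Per K S₂ - Per K (S₁ ∪ S₂)) / 2;
    let W : (EuclideanSpace ℝ (Fin 3) ≃ₗᵢ[ℝ] EuclideanSpace ℝ (Fin 3)) → Set (EuclideanSpace ℝ (Fin 3)) := fun A => {y | ∀ ν : EuclideanSpace ℝ (Fin 3), ⟪y, ν⟫_ℝ ≤ Φ (A.symm ν)};
    let Dsc : EuclideanSpace ℝ (Fin 3) → Set (EuclideanSpace ℝ (Fin 3)) := fun m => {y | ‖y‖ ≤ 1 ∧ ⟪y, m⟫_ℝ = 0};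
    let Tex : (n : ℕ) → (Fin n → Set (EuclideanSpace ℝ (Fin 3))) → (Fin n → (EuclideanSpace ℝ (Fin 3) ≃ₗᵢ[ℝ] EuclideanSpace ℝ (Fin 3))) → (Fin n → Fin n → ℝ) → (Fin n → Fin n → EuclideanSpace ℝ (Fin 3)) → Prop := fun n G A c m => (∀ f : Fin n, Literature.MathematicalPhysics.StatisticalMechanics.HasFinitePerimeter (G f) ∧ volume (G f) < ⊤) ∧ (∀ f g, f ≠ g → Disjoint (G f) (G g)) ∧ (∀ f g, f ≠ g → 0 ≤ c f g) ∧ (∀ f g, f ≠ g → ¬ CoAx (A f) (A g) → m f g = 0 ∧ 1 ≤ c f g) ∧ (∀ f g, f ≠ g → CoAx (A f) (A g) → A f '' Λ ≠ A g '' Λ → Ax (m f g) (A f) (A g) ∧ 1 / 2 ≤ c f g);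
    let En : (n : ℕ) → (Fin n → Set (EuclideanSpace ℝ (Fin 3))) → (Fin n → (EuclideanSpace ℝ (Fin 3) ≃ₗᵢ[ℝ] EuclideanSpace ℝ (Fin 3))) → (Fin n → Fin n → ℝ) → (Fin n → Fin n → EuclideanSpace ℝ (Fin 3)) → ℝ := fun n G A c m => ∑ f : Fin n, Per (W (A f)) (G f) - ∑ f, ∑ g, (if f = g then 0 else ι (W (A f)) (G f) (G g)) + ∑ f, ∑ g, (if f = g then 0 else c f g / 2 * ι (Dsc (m f g)) (G f) (G g));
    let Vol : (n : ℕ) → (Fin n → Set (EuclideanSpace ℝ (Fin 3))) → ℝ := fun n G => (volume (⋃ f : Fin n, G f)).toReal;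
    let Poly : Set (EuclideanSpace ℝ (Fin 3)) → Prop := fun S => ∃ (k : ℕ) (H : Fin k → Finset ((EuclideanSpace ℝ (Fin 3)) × ℝ)), S = ⋃ i, ⋂ p ∈ H i, {x | ⟪p.1, x⟫_ℝ < p.2};
    let TF : (n : ℕ) → (Fin n → (EuclideanSpace ℝ (Fin 3) ≃ₗᵢ[ℝ] EuclideanSpace ℝ (Fin 3))) → Prop := fun n A => ∀ f g : Fin n, f ≠ g → CoAx (A f) (A g) → A f '' Λ = A g '' Λ;
    ∀ (c₁ : ℝ) (n : ℕ) (G : Fin n → Set (EuclideanSpace ℝ (Fin 3))) (A : Fin n → (EuclideanSpace ℝ (Fin 3) ≃ₗᵢ[ℝ] EuclideanSpace ℝ (Fin 3))) (c : Fin n → Fin n → ℝ) (m : Fin n → Fin n → EuclideanSpace ℝ (Fin 3)) (f₀ : Fin n), Tex n G A c m → (∀ f, Poly (G f)) → TF n A → (∀ f g h : Fin n, A f '' Λ = A g '' Λ ∨ A g '' Λ = A h '' Λ ∨ A f '' Λ = A h '' Λ) → 0 ≤ c₁ → (∀ f g : Fin n, f ≠ g → ¬ CoAx (A f) (A g) →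 c₁ ≤ c f g) →
      ∃ vD s FD FS Y A₁ : ℝ, 0 ≤ vD ∧ 0 ≤ s ∧ 0 ≤ Y ∧ 0 ≤ A₁ ∧ Vol n G = vD + s ∧
        vD = (volume (⋃ g ∈ {g : Fin n | A g '' Λ = A f₀ '' Λ}, G g)).toReal ∧
        FD + FS + c₁ * A₁ ≤ En n G A c m ∧
        6 * (2 : ℝ) ^ ((1 : ℝ) / 3) * (Real.sqrt 2 * vD) ^ ((2 : ℝ) / 3) ≤ FD + Real.sqrt 5 * A₁ ∧
        6 * (2 : ℝ) ^ ((1 : ℝ) / 3) * (Real.sqrt 2 * s) ^ ((2 : ℝ) / 3) ≤ FS + Real.sqrt 5 * A₁ ∧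
        Real.sqrt 3 * Y ≤ FS ∧
        3 * (Real.pi * (24 * Real.sqrt 3 - 32)) ^ ((1 : ℝ) / 3) * (Vol n G) ^ ((2 : ℝ) / 3) ≤ FD + 2 * Y := by
  intro Λ Brl Ax CoAx Φ Per ι W Dsc Tex En Vol Poly TF c₁ n G A c m f₀ hTex hPoly hTF hTwo hc₁ hCh
  classical
  obtain ⟨hfin, hdisj, -, -, -⟩ := id hTex
  have hvol : ∀ f, volume (G f) < ⊤ := fun f => (hfin f).2
  obtain ⟨hEm, hEv, hEp, hVsum⟩ := texture_union_facts G hfin hdisj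
  -- lattice classes; the dominant class `D` and the satellites `Dc`
  set lat : Fin n → Set E3 := fun f => A f '' Λ with hlat
  set D : Finset (Fin n) := Finset.univ.filter (fun f => lat f = lat f₀) with hD
  set Dc : Finset (Fin n) := Finset.univ \ D with hDc
  have hmemD : ∀ f, f ∈ D ↔ lat f = lat f₀ := fun f => by simp [hD]
  have hmemDc : ∀ f, f ∈ Dc ↔ lat f ≠ lat f₀ := fun f => by simp [hDc, hD]
  have hDcsub : D ⊆ Finset.univ := Finset.subset_univ D
  have hBallc : ∀ r : ℝ, IsCompact (Metric.closedBall (0 : E3) r) := fun r => isCompact_closedBall 0 r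
  have hBallv : ∀ r : ℝ, Convex ℝ (Metric.closedBall (0 : E3) r) := fun r => convex_closedBall 0 r
  have hBall0 : ∀ {r : ℝ}, 0 ≤ r → (0 : E3) ∈ Metric.closedBall (0 : E3) r := fun hr =>
    Metric.mem_closedBall_self hr
  have hBalls : ∀ r : ℝ, -Metric.closedBall (0 : E3) r = Metric.closedBall 0 r := fun r => by
    rw [neg_closedBall, neg_zero]
  have hBc := hBallc 1; have hBv := hBallv 1; have hBs := hBalls 1; have hB0 : (0 : E3) ∈ Metric.closedBall (0 : E3) 1 := hBall0 zero_le_one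
  have h30 : (0 : ℝ) ≤ Real.sqrt 3 := Real.sqrt_nonneg 3; have h50 : (0 : ℝ) ≤ Real.sqrt 5 := Real.sqrt_nonneg 5; obtain ⟨h3pos, h5pos⟩ : (0 : ℝ) < Real.sqrt 3 ∧ (0 : ℝ) < Real.sqrt 5 := ⟨by positivity, by positivity⟩
  have hWc : ∀ f, IsCompact (W (A f)) := fun f => isCompact_cruxWulffBody (A f)
  have hWv : ∀ f, Convex ℝ (W (A f)) := fun f => convex_cruxWulffBody (A f)
  have hW0 : ∀ f, (0 : E3) ∈ W (A f) := fun f => zero_mem_cruxWulffBody (A f); have hWs : ∀ f, -W (A f) = W (A f) := fun f => neg_cruxWulffBody_eq (A f)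
  have hW5 : ∀ f, W (A f) ⊆ Metric.closedBall (0 : E3) (Real.sqrt 5) := fun f =>
    cruxWulffBody_subset_closedBall (A f)
  have hW3 : ∀ f, Metric.closedBall (0 : E3) (Real.sqrt 3) ⊆ W (A f) := fun f =>
    closedBall_subset_cruxWulffBody (A f)
  have hWeq : ∀ f g, lat f = lat g → W (A f) = W (A g) := fun f g h => wulffBody_eq_of_image_eq h
  set K₀ : Set E3 := W (A f₀) with hK₀
  have hKD : ∀ f ∈ D, W (A f) = K₀ := fun f hf => hWeq f f₀ ((hmemD f).1 hf)
  have hperBr : ∀ {r : ℝ}, 0 < r → ∀ S : Set E3, per (Metric.closedBall (0 : E3) r) S =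
      r * per (Metric.closedBall (0 : E3) 1) S := by
    intro r hr S
    rw [per_closedBall_eq_mul_perimeter hr, per_closedBall_eq_mul_perimeter one_pos, one_mul]
  -- one common refinement: walls / exterior / total clauses
  obtain ⟨k, H, ν, S, SX, hcross, hext, htot⟩ := exists_exterior_crossSums G hPoly hvol hdisj
  set X : Set E3 → Fin k → Fin k → ℝ := fun K a b =>
    (if a < b then (supportFn K (ν a b) + supportFn K (-ν a b)) *
        facetArea (closure (polytope (H a)) ∩ closure (polytope (H b))) (ν a b)
      else (supportFn K (ν b a) + supportFn K (-ν b a)) *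
        facetArea (closure (polytope (H b)) ∩ closure (polytope (H a))) (ν b a)) with hX
  -- the free energy of a grain w.r.t. a symmetric body `K` is half its exterior cross sum
  have hfree : ∀ K : Set E3, IsCompact K → Convex ℝ K → (0 : E3) ∈ K → -K = K → ∀ f,
      per K (G f) - ∑ g, (if f = g then 0 else (per K (G f) + per K (G g) - per K (G f ∪ G g)) / 2) =
        (∑ a ∈ S f, ∑ b ∈ SX, X K a b) / 2 := by
    intro K hK hKv hK0 hKs f
    have h : 2 * per K (G f) = (∑ g ∈ Finset.univ.erase f,
        (per K (G f) + per K (G g) - per K (G f ∪ G g))) + ∑ a ∈ S f, ∑ b ∈ SX, X K a b :=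
      hext K hK hKv hK0 hKs f
    rw [sum_ite_eq_sum_erase_div_two]
    linarith
  have hmono : ∀ {K K' : Set E3}, K ⊆ K' → Bornology.IsBounded K' → K.Nonempty → ∀ f,
      (∑ a ∈ S f, ∑ b ∈ SX, X K a b) ≤ ∑ a ∈ S f, ∑ b ∈ SX, X K' a b :=
    fun hKK' hK' hKne f => crossSum_mono hKK' hK' hKne H ν (S f) SX
  have hcs0 : ∀ {K : Set E3}, IsCompact K → (0 : E3) ∈ K → ∀ f, 0 ≤ ∑ a ∈ S f, ∑ b ∈ SX, X K a b :=
    fun hK hK0 f => crossSum_nonneg hK hK0 H ν (S f) SX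
  -- exterior areas `Y f` (unit ball) and their scaling
  set Y : Fin n → ℝ := fun f => (∑ a ∈ S f, ∑ b ∈ SX, X (Metric.closedBall (0 : E3) 1) a b) / 2 with hY
  have hYdef : ∀ f, Y f = (∑ a ∈ S f, ∑ b ∈ SX, X (Metric.closedBall (0 : E3) 1) a b) / 2 :=
    fun f => rfl
  have hY0 : ∀ f, 0 ≤ Y f := fun f => by rw [hYdef]; exact div_nonneg (hcs0 hBc hB0 f) zero_le_two
  have hscale : ∀ {r : ℝ}, 0 < r → ∀ f,
      (∑ a ∈ S f, ∑ b ∈ SX, X (Metric.closedBall (0 : E3) r) a b) / 2 = r * Y f := by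
    intro r hr f
    rw [hYdef, ← hfree _ (hBallc r) (hBallv r) (hBall0 hr.le) (hBalls r) f,
      ← hfree _ hBc hBv hB0 hBs f]
    simp_rw [hperBr hr]
    rw [mul_sub, Finset.mul_sum]
    congr 1
    refine Finset.sum_congr rfl fun g _ => ?_
    split_ifs <;> ring
  -- a grain's free energy is at least `√3 · Y f`; its `K₀`-free energy is at most `√5 · Y f`
  have hfree_ge : ∀ f, Real.sqrt 3 * Y f ≤ (∑ a ∈ S f, ∑ b ∈ SX, X (W (A f)) a b) / 2 := by
    intro f
    rw [← hscale h3pos f]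
    exact div_le_div_of_nonneg_right (hmono (hW3 f) (hWc f).isBounded ⟨0, hBall0 h30⟩ f) zero_le_two
  -- the unit-ball interface terms `w`
  set w : Fin n → Fin n → ℝ := fun f g => if f = g then 0 else
    (per (Metric.closedBall (0 : E3) 1) (G f) + per (Metric.closedBall (0 : E3) 1) (G g) -
      per (Metric.closedBall (0 : E3) 1) (G f ∪ G g)) / 2 with hw
  have hw0 : ∀ f g, 0 ≤ w f g := by
    intro f g
    by_cases hfg : f = g
    · simp only [hw, hfg, if_true]; exact le_rfl
    · simp only [hw, hfg, if_false]
      exact div_nonneg (iota_nonneg_of_poly G hPoly hvol hdisj hBc hBv hB0 hfg) zero_le_two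
  have hwsymm : ∀ f g, w f g = w g f := fun f g => iota_kernel_symm _ G f g
  -- `per_B (G f) = Σ_g w f g + Y f`
  have hperY : ∀ f, per (Metric.closedBall (0 : E3) 1) (G f) = (∑ g, w f g) + Y f := by
    intro f
    have h := hfree _ hBc hBv hB0 hBs f
    have hY' := hYdef f
    simp only [hw]
    linarith
  -- the dominant/satellite interface `A₁` and its mirror `A₂`
  set A₁ : ℝ := ∑ f ∈ D, ∑ g ∈ Dc, w f g with hA₁
  set A₂ : ℝ := ∑ f ∈ Dc, ∑ g ∈ D, w f g with hA₂
  have hA₁₂ : A₂ = A₁ := by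
    rw [hA₂, hA₁, Finset.sum_comm]
    exact Finset.sum_congr rfl fun f _ => Finset.sum_congr rfl fun g _ => hwsymm g f
  have hA₁0 : 0 ≤ A₁ := Finset.sum_nonneg fun f _ => Finset.sum_nonneg fun g _ => hw0 f g
  set Ysat : ℝ := ∑ f ∈ Dc, Y f with hYsat; have hYsat0 : 0 ≤ Ysat := Finset.sum_nonneg fun f _ => hY0 f
  have hsplit : ∀ F : Fin n → ℝ, (∑ f, F f) = (∑ f ∈ D, F f) + ∑ f ∈ Dc, F f := by
    intro F
    rw [hDc, ← Finset.sum_sdiff hDcsub, add_comm]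
  have hWallA : c₁ * A₁ ≤ ∑ f, ∑ g, (if f = g then 0 else c f g / 2 * ι (Dsc (m f g)) (G f) (G g)) :=
    walls_ge_chargedInterface c₁ n G A c m f₀ hTex hPoly hTF hc₁ hCh
  -- facts on the two merged families
  have hfactsD := subfamily_union_facts G hfin hdisj D
  have hfactsDc := subfamily_union_facts G hfin hdisj Dc
  set vD : ℝ := (volume (⋃ f ∈ D, G f)).toReal with hvD
  set s : ℝ := (volume (⋃ f ∈ Dc, G f)).toReal with hs
  have hvD0 : 0 ≤ vD := ENNReal.toReal_nonneg; have hs0 : 0 ≤ s := ENNReal.toReal_nonneg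
  have hV : Vol n G = vD + s := by
    show (volume (⋃ f, G f)).toReal = vD + s
    rw [hVsum, hfactsD.2.2.2, hfactsDc.2.2.2]
    exact hsplit _
  have hvDeq : vD = (volume (⋃ g ∈ {g : Fin n | A g '' Λ = A f₀ '' Λ}, G g)).toReal := by
    rw [hvD, show (⋃ f ∈ D, G f) = ⋃ g ∈ {g : Fin n | A g '' Λ = A f₀ '' Λ}, G g from by
      ext x; simp only [Set.mem_iUnion, Finset.mem_filter, Finset.mem_univ, true_and, Set.mem_setOf_eq,
        exists_prop, hlat, hD]]
  -- PER-CLASS BOUND for the dominant class (as in `rung_fineTwinFree_third`)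
  have hιW_le : ∀ f g, f ≠ g →
      per (W (A f)) (G f) + per (W (A f)) (G g) - per (W (A f)) (G f ∪ G g) ≤
        Real.sqrt 5 * (per (Metric.closedBall (0 : E3) 1) (G f) +
          per (Metric.closedBall (0 : E3) 1) (G g) - per (Metric.closedBall (0 : E3) 1) (G f ∪ G g)) := by
    intro f g hfg
    have h1 := hcross (W (A f)) (hWc f) (hWv f) (hW0 f) f g hfg
    have h2 := hcross (Metric.closedBall (0 : E3) (Real.sqrt 5)) (hBallc _) (hBallv _) (hBall0 h50) f g hfg
    have hmono' := crossSum_mono (hW5 f) Metric.isBounded_closedBall ⟨0, hW0 f⟩ H ν (S f) (S g)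
    rw [← h1, ← h2, hperBr h5pos, hperBr h5pos, hperBr h5pos] at hmono'
    linarith
  have hclassD : 6 * (2 : ℝ) ^ ((1 : ℝ) / 3) * (Real.sqrt 2 * vD) ^ ((2 : ℝ) / 3) - Real.sqrt 5 * A₁ ≤
      ∑ f ∈ D, (per (W (A f)) (G f) - ∑ g, (if f = g then 0 else
          (per (W (A f)) (G f) + per (W (A f)) (G g) - per (W (A f)) (G f ∪ G g)) / 2)) := by
    have hX' : (∑ f ∈ D, (per (W (A f)) (G f) - ∑ g, (if f = g then 0 else
          (per (W (A f)) (G f) + per (W (A f)) (G g) - per (W (A f)) (G f ∪ G g)) / 2))) =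
        ∑ f ∈ D, (per K₀ (G f) - ∑ g, (if f = g then 0 else
            (per K₀ (G f) + per K₀ (G g) - per K₀ (G f ∪ G g)) / 2)) :=
      Finset.sum_congr rfl fun f hf => by rw [hKD f hf]
    rw [hX', freeEnergy_class_eq_merged G hPoly hvol hdisj (hWc f₀) (hWv f₀) (hW0 f₀) (hWs f₀) _]
    have hWulff : 6 * (2 : ℝ) ^ ((1 : ℝ) / 3) * (Real.sqrt 2 * vD) ^ ((2 : ℝ) / 3) ≤
        per K₀ (⋃ f ∈ D, G f) :=
      polycrystalWulffBound_singleGrain (A f₀) ⟨hfactsD.1, lt_top_iff_ne_top.2 hfactsD.2.2.1⟩ hfactsD.2.1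
    have hover : (∑ g ∈ Finset.univ \ D,
        (per K₀ (⋃ f ∈ D, G f) + per K₀ (G g) - per K₀ ((⋃ f ∈ D, G f) ∪ G g)) / 2) ≤
        Real.sqrt 5 * A₁ := by
      have hadd : ∀ g ∈ Finset.univ \ D,
          (per K₀ (⋃ f ∈ D, G f) + per K₀ (G g) - per K₀ ((⋃ f ∈ D, G f) ∪ G g)) / 2 ≤
          Real.sqrt 5 * ∑ f ∈ D, w f g := by
        intro g hg
        have hg' : g ∉ D := (Finset.mem_sdiff.1 hg).2
        rw [two_iota_biUnion_left G hPoly hvol hdisj (hWc f₀) (hWv f₀) (hW0 f₀) (hWs f₀) hg',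
          Finset.sum_div, Finset.mul_sum]
        refine Finset.sum_le_sum fun f hf => ?_
        have hfg : f ≠ g := fun h => hg' (h ▸ hf)
        have hle := hιW_le f g hfg
        rw [hKD f hf] at hle
        simp only [hw, hfg, if_false]
        nlinarith
      refine (Finset.sum_le_sum hadd).trans (le_of_eq ?_)
      rw [← Finset.mul_sum, Finset.sum_comm]
    linarith
  -- PER-CLASS BOUND for the satellite class `S = Dc` (one lattice class, by `hTwo`)
  have hDD : Finset.univ \ Dc = D := by rw [hDc]; exact Finset.sdiff_sdiff_eq_self hDcsub
  have hclassS : 6 * (2 : ℝ) ^ ((1 : ℝ) / 3) * (Real.sqrt 2 * s) ^ ((2 : ℝ) / 3) - Real.sqrt 5 * A₁ ≤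
      ∑ f ∈ Dc, (per (W (A f)) (G f) - ∑ g, (if f = g then 0 else
          (per (W (A f)) (G f) + per (W (A f)) (G g) - per (W (A f)) (G f ∪ G g)) / 2)) := by
    rcases Dc.eq_empty_or_nonempty with hDce | ⟨f₁, hf₁⟩
    · have hs00 : s = 0 := by rw [hs, hDce]; simp
      rw [hs00, hDce, mul_zero, Real.zero_rpow (by norm_num), mul_zero, Finset.sum_empty]
      linarith [mul_nonneg h50 hA₁0]
    have hlf₁ : lat f₁ ≠ lat f₀ := (hmemDc f₁).1 hf₁
    have hsame : ∀ f ∈ Dc, lat f = lat f₁ := by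
      intro f hf
      have hlf : lat f ≠ lat f₀ := (hmemDc f).1 hf
      rcases hTwo f f₁ f₀ with h | h | h
      · exact h
      · exact absurd h hlf₁
      · exact absurd h hlf
    set K₁ : Set E3 := W (A f₁) with hK₁
    have hKDc : ∀ f ∈ Dc, W (A f) = K₁ := fun f hf => hWeq f f₁ (hsame f hf)
    have hX' : (∑ f ∈ Dc, (per (W (A f)) (G f) - ∑ g, (if f = g then 0 else
          (per (W (A f)) (G f) + per (W (A f)) (G g) - per (W (A f)) (G f ∪ G g)) / 2))) =
        ∑ f ∈ Dc, (per K₁ (G f) - ∑ g, (if f = g then 0 else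
            (per K₁ (G f) + per K₁ (G g) - per K₁ (G f ∪ G g)) / 2)) :=
      Finset.sum_congr rfl fun f hf => by rw [hKDc f hf]
    rw [hX', freeEnergy_class_eq_merged G hPoly hvol hdisj (hWc f₁) (hWv f₁) (hW0 f₁) (hWs f₁) _, hDD]
    have hWulff : 6 * (2 : ℝ) ^ ((1 : ℝ) / 3) * (Real.sqrt 2 * s) ^ ((2 : ℝ) / 3) ≤
        per K₁ (⋃ f ∈ Dc, G f) :=
      polycrystalWulffBound_singleGrain (A f₁) ⟨hfactsDc.1, lt_top_iff_ne_top.2 hfactsDc.2.2.1⟩ hfactsDc.2.1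
    have hover : (∑ g ∈ D,
        (per K₁ (⋃ f ∈ Dc, G f) + per K₁ (G g) - per K₁ ((⋃ f ∈ Dc, G f) ∪ G g)) / 2) ≤
        Real.sqrt 5 * A₁ := by
      have hadd : ∀ g ∈ D,
          (per K₁ (⋃ f ∈ Dc, G f) + per K₁ (G g) - per K₁ ((⋃ f ∈ Dc, G f) ∪ G g)) / 2 ≤
          Real.sqrt 5 * ∑ f ∈ Dc, w f g := by
        intro g hg
        have hg' : g ∉ Dc := fun h => (Finset.mem_sdiff.1 h).2 hg
        rw [two_iota_biUnion_left G hPoly hvol hdisj (hWc f₁) (hWv f₁) (hW0 f₁) (hWs f₁) hg',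
          Finset.sum_div, Finset.mul_sum]
        refine Finset.sum_le_sum fun f hf => ?_
        have hfg : f ≠ g := fun h => hg' (h ▸ hf)
        have hle := hιW_le f g hfg
        rw [hKDc f hf] at hle
        simp only [hw, hfg, if_false]
        nlinarith
      refine (Finset.sum_le_sum hadd).trans (le_of_eq ?_)
      rw [← Finset.mul_sum, Finset.sum_comm, ← hA₁₂]
    linarith
  -- satellites: free energy ≥ √3 · Y
  have hsat : Real.sqrt 3 * Ysat ≤ ∑ f ∈ Dc, (per (W (A f)) (G f) - ∑ g, (if f = g then 0 else
      (per (W (A f)) (G f) + per (W (A f)) (G g) - per (W (A f)) (G f ∪ G g)) / 2)) := by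
    rw [hYsat, Finset.mul_sum]
    refine Finset.sum_le_sum fun f _ => ?_
    rw [hfree _ (hWc f) (hWv f) (hW0 f) (hWs f) f]
    exact hfree_ge f
  -- BALL-CUT ROW: `L = K₀ ∩ B̄(0,2)` lies in `K₀` (the body of `D`) and in `B̄(0,2)` (charged on `S`)
  set Bl : Set E3 := Metric.closedBall (0 : E3) 2 with hBl
  set L : Set E3 := K₀ ∩ Bl with hL
  have hLc : IsCompact L := (hWc f₀).inter (hBallc 2)
  have hLv : Convex ℝ L := (hWv f₀).inter (hBallv 2)
  have hL0 : (0 : E3) ∈ L := ⟨hW0 f₀, hBall0 zero_le_two⟩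
  have hLs : -L = L := by rw [hL, Set.inter_neg, hWs f₀, hBalls 2]
  set Kb : Fin n → Set E3 := fun f => if f ∈ D then K₀ else Bl with hKb
  have hKbD : ∀ f ∈ D, Kb f = K₀ := fun f hf => by simp only [hKb, hf, if_true]
  have hKbDc : ∀ f ∈ Dc, Kb f = Bl := fun f hf => by
    simp only [hKb, (Finset.mem_sdiff.1 hf).2, if_false]
  have hKbc : ∀ f, IsCompact (Kb f) := fun f => by
    by_cases hf : f ∈ D
    · rw [hKbD f hf]; exact hWc f₀
    · simp only [hKb, hf, if_false]; exact hBallc 2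
  have hKbv : ∀ f, Convex ℝ (Kb f) := fun f => by
    by_cases hf : f ∈ D
    · rw [hKbD f hf]; exact hWv f₀
    · simp only [hKb, hf, if_false]; exact hBallv 2
  have hKb0 : ∀ f, (0 : E3) ∈ Kb f := fun f => by
    by_cases hf : f ∈ D
    · rw [hKbD f hf]; exact hW0 f₀
    · simp only [hKb, hf, if_false]; exact hBall0 zero_le_two
  have hKbs : ∀ f, -Kb f = Kb f := fun f => by
    by_cases hf : f ∈ D
    · rw [hKbD f hf]; exact hWs f₀
    · simp only [hKb, hf, if_false]; exact hBalls 2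
  have hLsub : ∀ f, L ⊆ Kb f := fun f => by
    by_cases hf : f ∈ D
    · rw [hKbD f hf]; exact Set.inter_subset_left
    · simp only [hKb, hf, if_false]; exact Set.inter_subset_right
  have hperL := per_iUnion_le_freeEnergy G hPoly hvol hdisj Kb hKbc hKbv hKb0 hKbs hLc hLv hL0 hLs hLsub
  have hDpartL : (∑ f ∈ D, (per (Kb f) (G f) - ∑ g, (if f = g then 0 else
        (per (Kb f) (G f) + per (Kb f) (G g) - per (Kb f) (G f ∪ G g)) / 2))) =
      ∑ f ∈ D, (per (W (A f)) (G f) - ∑ g, (if f = g then 0 else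
        (per (W (A f)) (G f) + per (W (A f)) (G g) - per (W (A f)) (G f ∪ G g)) / 2)) :=
    Finset.sum_congr rfl fun f hf => by rw [hKbD f hf, hKD f hf]
  have hDcpartL : (∑ f ∈ Dc, (per (Kb f) (G f) - ∑ g, (if f = g then 0 else
        (per (Kb f) (G f) + per (Kb f) (G g) - per (Kb f) (G f ∪ G g)) / 2))) = 2 * Ysat := by
    rw [hYsat, Finset.mul_sum]
    refine Finset.sum_congr rfl fun f hf => ?_
    rw [hKbDc f hf, hfree _ (hBallc 2) (hBallv 2) (hBall0 zero_le_two) (hBalls 2) f, hscale two_pos f]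
  have hperL' : per L (⋃ f, G f) ≤ (∑ f ∈ D, (per (W (A f)) (G f) - ∑ g, (if f = g then 0 else
        (per (W (A f)) (G f) + per (W (A f)) (G g) - per (W (A f)) (G f ∪ G g)) / 2))) + 2 * Ysat := by
    rw [← hDpartL, ← hDcpartL, ← hsplit]
    exact hperL
  have hWulffL := wulff_le_per hLc hLv hL0 ⟨hEm, lt_top_iff_ne_top.2 hEp⟩ hEv
  have ha0 : 0 ≤ Real.pi * (24 * Real.sqrt 3 - 32) := by
    have h3 := sqrt_three_lower_fine
    exact mul_nonneg Real.pi_pos.le (by linarith)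
  have hLvol : Real.pi * (24 * Real.sqrt 3 - 32) ≤ (volume L).toReal :=
    (ENNReal.ofReal_le_iff_le_toReal hLc.measure_lt_top.ne).1
      (volume_cruxWulffBody_inter_closedBall_two_ge (A f₀))
  have hroot : (Real.pi * (24 * Real.sqrt 3 - 32)) ^ ((1 : ℝ) / 3) ≤ (volume L).toReal ^ ((1 : ℝ) / 3) :=
    Real.rpow_le_rpow ha0 hLvol (by norm_num)
  have hVnn : 0 ≤ Vol n G := ENNReal.toReal_nonneg
  have hV23 : 0 ≤ Vol n G ^ ((2 : ℝ) / 3) := Real.rpow_nonneg hVnn _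
  have hball : 3 * (Real.pi * (24 * Real.sqrt 3 - 32)) ^ ((1 : ℝ) / 3) * Vol n G ^ ((2 : ℝ) / 3) ≤
      (∑ f ∈ D, (per (W (A f)) (G f) - ∑ g, (if f = g then 0 else
        (per (W (A f)) (G f) + per (W (A f)) (G g) - per (W (A f)) (G f ∪ G g)) / 2))) + 2 * Ysat := by
    have h1 : 3 * (Real.pi * (24 * Real.sqrt 3 - 32)) ^ ((1 : ℝ) / 3) * Vol n G ^ ((2 : ℝ) / 3) ≤
        3 * (volume L).toReal ^ ((1 : ℝ) / 3) * Vol n G ^ ((2 : ℝ) / 3) :=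
      mul_le_mul_of_nonneg_right (mul_le_mul_of_nonneg_left hroot (by norm_num)) hV23
    have h2 : 3 * (volume L).toReal ^ ((1 : ℝ) / 3) * Vol n G ^ ((2 : ℝ) / 3) ≤ per L (⋃ f, G f) := hWulffL
    linarith
  -- assemble
  have hEn : En n G A c m =
      (∑ f, (Per (W (A f)) (G f) - ∑ g, (if f = g then 0 else ι (W (A f)) (G f) (G g)))) +
        ∑ f, ∑ g, (if f = g then 0 else c f g / 2 * ι (Dsc (m f g)) (G f) (G g)) := by
    show (∑ f, Per (W (A f)) (G f) -
        ∑ f, ∑ g, (if f = g then 0 else ι (W (A f)) (G f) (G g)) +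
        ∑ f, ∑ g, (if f = g then 0 else c f g / 2 * ι (Dsc (m f g)) (G f) (G g))) =
      (∑ f, (Per (W (A f)) (G f) - ∑ g, (if f = g then 0 else ι (W (A f)) (G f) (G g)))) +
        ∑ f, ∑ g, (if f = g then 0 else c f g / 2 * ι (Dsc (m f g)) (G f) (G g))
    rw [Finset.sum_sub_distrib]
  have hFree : (∑ f, (Per (W (A f)) (G f) - ∑ g, (if f = g then 0 else ι (W (A f)) (G f) (G g)))) =
      (∑ f ∈ D, (per (W (A f)) (G f) - ∑ g, (if f = g then 0 else
          (per (W (A f)) (G f) + per (W (A f)) (G g) - per (W (A f)) (G f ∪ G g)) / 2))) +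
        ∑ f ∈ Dc, (per (W (A f)) (G f) - ∑ g, (if f = g then 0 else
          (per (W (A f)) (G f) + per (W (A f)) (G g) - per (W (A f)) (G f ∪ G g)) / 2)) :=
    hsplit _
  have hα : (∑ f ∈ D, (per (W (A f)) (G f) - ∑ g, (if f = g then 0 else
          (per (W (A f)) (G f) + per (W (A f)) (G g) - per (W (A f)) (G f ∪ G g)) / 2))) +
      (∑ f ∈ Dc, (per (W (A f)) (G f) - ∑ g, (if f = g then 0 else
          (per (W (A f)) (G f) + per (W (A f)) (G g) - per (W (A f)) (G f ∪ G g)) / 2))) +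
      c₁ * A₁ ≤ En n G A c m := by
    rw [hEn, hFree]; linarith
  refine ⟨vD, s, _, _, Ysat, A₁, hvD0, hs0, hYsat0, hA₁0, hV, hvDeq, hα, ?_, ?_, hsat, hball⟩
  · linarith [hclassD]
  · linarith [hclassS]

end Summit.Ventures.Crystal3D.Cruxes.PolycrystalWulffBound.PolyDensity

end
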